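import Literature.NumberTheory.GaloisRepresentations.PrimeSquareCyclic
import HarnessLib

/-!
# The different along a subfield, and the ramification jump in prime degree (all primes)

Two general-form complements to `PrimeDegreeDifferent.lean` / `PrimeSquareCyclic.lean`, needed
for the `2`-power part of the Kronecker–Weber theorem (Marcus, *Number Fields*, Ch. 4, Ex. 32),
in the tree's setting `(R, K, L)`, `S = integralClosure R L`, `𝔓` maximal:

* `emultiplicity_differentIdeal_eq_finsum_add_card_mul` —
  `v_𝔓(𝔇_{S/R}) = Σ_{s ∈ H, s ≠ 1} i_G(s) + e(𝔓|𝔓_F) v_{𝔓_F}(𝔇_{S_F/R})` for an intermediate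
  field `F` with `H = Gal(L/F) ≤ D_𝔓` (transitivity of the different + Hilbert's formula).
* `exists_jump_of_prime_degree` — in prime degree `p` (any `p`), at a totally ramified `𝔓 ∋ p`
  with `p ∉ 𝔭²`: the unique jump `t ≥ 1`, `v_𝔓(𝔇_{S/R}) = (p-1)(t+1) ≤ 2p - 1`.

## References

* J.-P. Serre, *Local Fields*, GTM 67 (1979), Ch. III §4 Prop. 8, §6; Ch. IV §1 Prop. 4.
  [SerreLocalFields1979]
* D. A. Marcus, *Number Fields*, 2nd ed. (2018), Ch. 4, Ex. 33–34. [Marcus2018]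
-/

open Polynomial
open scoped Pointwise IsMulCommutative

noncomputable section

namespace Literature.NumberTheory.GaloisRepresentations

variable (R : Type*) {K L : Type*} [CommRing R] [IsDedekindDomain R] [Field K] [Field L]
  [Algebra R K] [IsFractionRing R K] [Algebra R L] [Algebra K L] [IsScalarTower R K L]
  [FiniteDimensional K L] [IsGalois K L]

/-- **The different of `S/R` along a subfield** (transitivity + Hilbert, Marcus Ch. 4 Ex. 34(d)
in general form).  Let `R` be Dedekind with fraction field `K`, `L/K` finite Galois with group
`G`, `S = integralClosure R L`, `𝔓 ≠ 0` a maximal ideal of `S` with finite residue field, and `F`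
an intermediate field whose group `H = Gal(L/F)` fixes `𝔓` (`H ≤ D_𝔓`).  Then
`v_𝔓(𝔇_{S/R}) = Σ_{s ∈ H, s ≠ 1} i_G(s) + e(𝔓 | 𝔓_F) · v_{𝔓_F}(𝔇_{S_F/R})`, `𝔓_F = 𝔓 ∩ S_F`,
`e(𝔓 | 𝔓_F) = #(T_𝔓 ∩ H)` (`ramificationIdx'_under_eq_card_inertia`):
transitivity of the different at `𝔓` (`emultiplicity_differentIdeal_eq_add`) and Hilbert's
formula for `S/S_F` (`emultiplicity_differentIdeal_eq_finsum_lowerIndex`).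
Ref: Serre, *Local Fields*, Ch. III §4 Prop. 8, Ch. IV §1 Prop. 4; Marcus, Ch. 4, Ex. 34(d).
[cite: SerreLocalFields1979, Ch. III §4 Prop. 8 and Ch. IV §1 Prop. 4] -/
theorem emultiplicity_differentIdeal_eq_finsum_add_card_mul
    [IsDedekindDomain (integralClosure R L)] [Module.IsTorsionFree R (integralClosure R L)]
    (F : IntermediateField K L) [IsDedekindDomain (integralClosure R F)]
    [Module.IsTorsionFree R (integralClosure R F)]
    (𝔓 : Ideal (integralClosure R L)) [𝔓.IsMaximal] (h𝔓 : 𝔓 ≠ ⊥)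
    [Finite (integralClosure R L ⧸ 𝔓)]
    (hD : F.fixingSubgroup ≤ 𝔓.decompositionSubgroup (L ≃ₐ[K] L)) :
    emultiplicity 𝔓 (differentIdeal R (integralClosure R L)) =
      (∑ᶠ (s : L ≃ₐ[K] L) (_ : s ∈ F.fixingSubgroup ∧ s ≠ 1), lowerIndex 𝔓 (L ≃ₐ[K] L) s) +
        Nat.card (𝔓.inertia F.fixingSubgroup) *
          emultiplicity (𝔓.comap (F.integralClosureInclusion R))
            (differentIdeal R (integralClosure R F)) := by
  classical
  haveI h𝔓prime : 𝔓.IsPrime := Ideal.IsMaximal.isPrime inferInstance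
  haveI : FaithfulSMul (L ≃ₐ[K] L) (integralClosure R L) := faithfulSMul_algEquiv_integralClosure R
  haveI : IsFractionRing (integralClosure R L) L :=
    integralClosure.isFractionRing_of_finite_extension K L
  haveI : (𝔓.under R).IsMaximal := Ideal.IsMaximal.under R 𝔓
  haveI : Algebra.IsSeparable (R ⧸ 𝔓.under R) (integralClosure R L ⧸ 𝔓) :=
    isSeparable_residue_of_finite 𝔓
  -- the tower `R → S_F → S_L`
  letI := integralClosureAlgebra R F (L := L)
  haveI := integralClosure_isScalarTower_left R F (L := L)
  haveI := integralClosure_isScalarTower_bot R F (L := L)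
  haveI := integralClosure_faithfulSMul R F (L := L)
  haveI := integralClosure_isIntegral R F (L := L)
  haveI := integralClosure_isTorsionFree R F (K := K) (L := L)
  haveI := isMaximal_under_integralClosure R F 𝔓 (K := K) (L := L)
  haveI := under_integralClosure_liesOver R F 𝔓 (K := K) (L := L)
  haveI := integralClosure_moduleFinite R F (K := K) (L := L)
  haveI : IsFractionRing (integralClosure R F) F :=
    integralClosure.isFractionRing_of_finite_extension K F
  haveI : Module.Finite R (integralClosure R F) :=
    IsIntegralClosure.finite R K F (integralClosure R F)
  haveI : Module.Finite R (integralClosure R L) :=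
    IsIntegralClosure.finite R K L (integralClosure R L)
  -- separability of `Frac(S_L)/Frac(R)`, transported from `L/K`
  letI aS : Algebra (integralClosure R L) (FractionRing (integralClosure R L)) :=
    OreLocalization.instAlgebra
  letI sS : SMul (integralClosure R L) (FractionRing (integralClosure R L)) := aS.toSMul
  letI a₁ : Algebra R (FractionRing (integralClosure R L)) := OreLocalization.instAlgebra
  letI s₁ : SMul R (FractionRing (integralClosure R L)) := a₁.toSMul
  haveI : IsScalarTower R (integralClosure R L) (FractionRing (integralClosure R L)) :=
    IsScalarTower.of_algebraMap_eq fun _ => rfl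
  haveI : FaithfulSMul R (FractionRing (integralClosure R L)) := by
    haveI : FaithfulSMul R (integralClosure R L) := faithfulSMul_integralClosure R (K := K) (L := L)
    exact FaithfulSMul.trans R (integralClosure R L) _
  letI a₁₁ : Algebra R (FractionRing R) := OreLocalization.instAlgebra
  letI s₁₁ : SMul R (FractionRing R) := a₁₁.toSMul
  letI aFF : Algebra (FractionRing R) (FractionRing (integralClosure R L)) :=
    FractionRing.liftAlgebra _ _
  letI sFF : SMul (FractionRing R) (FractionRing (integralClosure R L)) := aFF.toSMul
  haveI : IsScalarTower R (FractionRing R) (FractionRing (integralClosure R L)) :=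
    FractionRing.isScalarTower_liftAlgebra _ _
  haveI : Algebra.IsSeparable (FractionRing R) (FractionRing (integralClosure R L)) := by
    refine Algebra.IsSeparable.of_equiv_equiv (FractionRing.algEquiv R K).symm.toRingEquiv
      (FractionRing.algEquiv (integralClosure R L) L).symm.toRingEquiv ?_
    ext _
    exact IsFractionRing.algEquiv_commutes (FractionRing.algEquiv R K).symm
      (FractionRing.algEquiv (integralClosure R L) L).symm _
  -- transitivity of the different along `R → S_F → S_L` at `𝔓`
  have HT := emultiplicity_differentIdeal_eq_add (A := R) (B := integralClosure R F)
    (C := integralClosure R L) 𝔓 h𝔓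
  -- Hilbert's formula for `S_L/S_F`
  have hHilbF := emultiplicity_differentIdeal_eq_finsum_lowerIndex R F 𝔓 h𝔓 hD
  have hcomap : 𝔓.comap (F.integralClosureInclusion R) = 𝔓.under (integralClosure R F) :=
    Ideal.ext fun _ => Iff.rfl
  rw [hcomap, HT, hHilbF, ramificationIdx'_under_eq_card_inertia R F 𝔓 h𝔓]

/-- **The ramification jump in prime degree** (Marcus, Ch. 4, Ex. 33, for every prime `p`).
`R` Dedekind with fraction field `K`, `L/K` Galois of prime degree `p`, `𝔓 ≠ 0` a maximal ideal
of `S = integralClosure R L` with finite residue field, totally ramified, with `p ∈ 𝔓` and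
`p ∉ 𝔭²` (`𝔭 = 𝔓 ∩ R`).  Then `G = V₁` has a single jump `t ≥ 1` (`i_G(s) = t + 1` for `s ≠ 1`),
`v_𝔓(𝔇_{S/R}) = (p-1)(t+1)` (Hilbert), and `(p-1)(t+1) ≤ 2p - 1` (Eisenstein bound on `f'(π)`;
Serre's `v(𝔇) ≤ e - 1 + v(e)`).  For odd `p` this forces `t = 1`
(`lowerIndex_eq_two_of_prime_degree`); for `p = 2`, `t ∈ {1, 2}` (`ℚ(i)`, resp. `ℚ(√±2)`).
[cite: Marcus2018, Ch. 4, Ex. 33 (p. 102)] -/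
theorem exists_jump_of_prime_degree [IsDedekindDomain (integralClosure R L)]
    [Module.IsTorsionFree R (integralClosure R L)]
    (𝔓 : Ideal (integralClosure R L)) [𝔓.IsMaximal] (h𝔓 : 𝔓 ≠ ⊥)
    [Finite (integralClosure R L ⧸ 𝔓)]
    {p : ℕ} (hp : p.Prime) (hcard : Nat.card (L ≃ₐ[K] L) = p)
    (htot : 𝔓.inertia (L ≃ₐ[K] L) = ⊤)
    (hpP : (p : integralClosure R L) ∈ 𝔓) (hp𝔭 : (p : R) ∉ (𝔓.under R) ^ 2) :
    ∃ t : ℕ, 1 ≤ t ∧ (∀ s : L ≃ₐ[K] L, s ≠ 1 → lowerIndex 𝔓 (L ≃ₐ[K] L) s = ((t + 1 : ℕ) : ℕ∞)) ∧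
      emultiplicity 𝔓 (differentIdeal R (integralClosure R L)) = (((p - 1) * (t + 1) : ℕ) : ℕ∞) ∧
      (p - 1) * (t + 1) < 2 * p := by
  classical
  haveI : Fintype (L ≃ₐ[K] L) := Fintype.ofFinite _
  haveI : FaithfulSMul (L ≃ₐ[K] L) (integralClosure R L) := faithfulSMul_algEquiv_integralClosure R
  haveI : IsFractionRing (integralClosure R L) L :=
    integralClosure.isFractionRing_of_finite_extension K L
  letI : Field (integralClosure R L ⧸ 𝔓) := Ideal.Quotient.field 𝔓
  haveI h𝔓prime : 𝔓.IsPrime := Ideal.IsMaximal.isPrime inferInstance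
  haveI : (𝔓.under R).IsMaximal := Ideal.IsMaximal.under R 𝔓
  haveI : Algebra.IsSeparable (R ⧸ 𝔓.under R) (integralClosure R L ⧸ 𝔓) :=
    isSeparable_residue_of_finite 𝔓
  haveI : Fact (Nat.card (L ≃ₐ[K] L)).Prime := ⟨by rw [hcard]; exact hp⟩
  have hcardF : Fintype.card (L ≃ₐ[K] L) = p := by rw [← Nat.card_eq_fintype_card, hcard]
  have hstab : ∀ g : L ≃ₐ[K] L, g • 𝔓 = 𝔓 := smul_eq_of_inertia_eq_top htot
  have hV0 : 𝔓.ramificationSubgroup (L ≃ₐ[K] L) 0 = ⊤ := ramificationSubgroup_zero_eq_top R 𝔓 htot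
  -- residue characteristic `p`
  have hchar : ringChar (integralClosure R L ⧸ 𝔓) = p := by
    have h1 : ringChar (integralClosure R L ⧸ 𝔓) ∣ p := by
      refine ringChar.dvd ?_
      rw [← map_natCast (Ideal.Quotient.mk 𝔓), Ideal.Quotient.eq_zero_iff_mem]
      exact hpP
    rcases (Nat.dvd_prime hp).mp h1 with h | h
    · exact absurd h CharP.ringChar_ne_one
    · exact h
  -- Step 1: `V₁ = G`
  have hV1 : 𝔓.ramificationSubgroup (L ≃ₐ[K] L) 1 = ⊤ := by
    have hcop := relIndex_ramificationSubgroup_one_coprime_ringChar (G := L ≃ₐ[K] L) h𝔓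
    rw [hV0, Subgroup.relIndex_top_right, hchar] at hcop
    have hdvd : (𝔓.ramificationSubgroup (L ≃ₐ[K] L) 1).index ∣ p :=
      hcard ▸ Subgroup.index_dvd_card _
    exact Subgroup.index_eq_one.mp (Nat.Coprime.eq_one_of_dvd hcop hdvd)
  -- Step 2: the unique jump `t ≥ 1`: `V_t = G`, `V_{t+1} = 1`
  obtain ⟨N, hN⟩ := Ideal.ramificationSubgroup_eventually_eq_bot_holds 𝔓 (L ≃ₐ[K] L)
    (Ideal.IsMaximal.ne_top inferInstance)
  have hex : ∃ n, 𝔓.ramificationSubgroup (L ≃ₐ[K] L) n = ⊥ := ⟨N, hN N le_rfl⟩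
  have hnontriv : (⊤ : Subgroup (L ≃ₐ[K] L)) ≠ ⊥ := by
    intro h
    have h1 := Subgroup.card_top (G := L ≃ₐ[K] L)
    rw [h, Subgroup.card_bot, hcard] at h1
    exact hp.one_lt.ne h1
  have hn₀2 : 2 ≤ Nat.find hex := by
    by_contra hlt
    have hbot := Nat.find_spec hex
    rcases Nat.le_one_iff_eq_zero_or_eq_one.mp (by omega : Nat.find hex ≤ 1) with h | h
    · rw [h, hV0] at hbot; exact hnontriv hbot
    · rw [h, hV1] at hbot; exact hnontriv hbot
  set t := Nat.find hex - 1 with ht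
  have ht1 : 1 ≤ t := by omega
  have hVt : 𝔓.ramificationSubgroup (L ≃ₐ[K] L) t = ⊤ :=
    (Subgroup.eq_bot_or_eq_top_of_prime_card _).resolve_left (Nat.find_min hex (by omega))
  have hVt1 : 𝔓.ramificationSubgroup (L ≃ₐ[K] L) (t + 1) = ⊥ := by
    rw [show t + 1 = Nat.find hex by omega]; exact Nat.find_spec hex
  have hidx : ∀ s : L ≃ₐ[K] L, s ≠ 1 → lowerIndex 𝔓 (L ≃ₐ[K] L) s = ((t + 1 : ℕ) : ℕ∞) := by
    intro s hs
    apply le_antisymm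
    · rw [lowerIndex_le_natCast_iff, hVt1]
      exact fun h => hs (Subgroup.mem_bot.mp h)
    · have := add_one_le_lowerIndex 𝔓 (show s ∈ 𝔓.ramificationSubgroup (L ≃ₐ[K] L) t from
        hVt ▸ Subgroup.mem_top s)
      exact_mod_cast this
  -- Step 3: Hilbert's formula `v_𝔓(𝔇) = (p - 1)(t + 1)`
  have hHilb := emultiplicity_differentIdeal_base_eq_finsum_lowerIndex R 𝔓 h𝔓 hstab
  have hsum : ∑ᶠ (s : L ≃ₐ[K] L) (_ : s ≠ 1), lowerIndex 𝔓 (L ≃ₐ[K] L) s =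
      (((p - 1) * (t + 1) : ℕ) : ℕ∞) := by
    rw [finsum_cond_eq_sum_of_cond_iff (t := (Finset.univ : Finset (L ≃ₐ[K] L)).erase 1) _
        (fun {s} _ => by simp), Finset.sum_congr rfl fun s hs => hidx s (Finset.ne_of_mem_erase hs),
      Finset.sum_const, Finset.card_erase_of_mem (Finset.mem_univ _), Finset.card_univ, hcardF]
    push_cast
    rw [nsmul_eq_mul]
    push_cast [Nat.cast_sub hp.one_le]
    ring
  -- Step 4: the Eisenstein bound `v_𝔓(𝔇) ≤ 2p - 1`
  have hbound : ¬ (((2 * p : ℕ) : ℕ∞) ≤ emultiplicity 𝔓 (differentIdeal R (integralClosure R L))) := by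
    intro hle
    -- a uniformizer `π`; `g π ≠ π` for `g ≠ 1` as `i_G(g) = v_𝔓(g π - π) < ∞`
    obtain ⟨π, hπ, hπ2⟩ := Ideal.exists_mem_pow_notMem_pow_succ 𝔓 h𝔓
      (Ideal.IsMaximal.ne_top inferInstance) 1
    rw [pow_one] at hπ
    have hgπ : ∀ g : L ≃ₐ[K] L, g • π ∈ 𝔓 := fun g => by
      have h := Ideal.smul_mem_pointwise_smul g _ _ hπ
      rwa [hstab g] at h
    have hne1 : ∀ g : L ≃ₐ[K] L, g ≠ 1 → g • π ≠ π := fun g hg h => by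
      have h1 := lowerIndex_eq_ord_smul_sub R 𝔓 h𝔓 htot hπ hπ2 g
      rw [h, sub_self, ord_zero] at h1
      exact lowerIndex_ne_top 𝔓 (hN N le_rfl) hg h1
    have hinj : Function.Injective fun g : L ≃ₐ[K] L => g • π := by
      intro g₁ g₂ h
      have : (g₂⁻¹ * g₁) • π = π := by
        rw [mul_smul, show g₁ • π = g₂ • π from h, inv_smul_smul]
      by_contra hne
      exact hne1 (g₂⁻¹ * g₁) (fun h' => hne (inv_mul_eq_one.mp h').symm) this
    -- `Q = ∏ (X - g π)` is the minimal polynomial `P` of `π` over `R`, mapped to `S`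
    set Q : (integralClosure R L)[X] := ∏ g : L ≃ₐ[K] L, (X - C (g • π)) with hQ
    have hQmonic : Q.Monic := monic_prod_of_monic _ _ fun g _ => monic_X_sub_C _
    have hQdeg : Q.natDegree = p := by
      rw [hQ, natDegree_prod_of_monic _ _ fun g _ => monic_X_sub_C _]
      simp [hcardF]
    have hxint : IsIntegral R π := Algebra.IsIntegral.isIntegral π
    set P := minpoly R π with hP
    have hPmonic : P.Monic := minpoly.monic hxint
    have hQeq : Q = (Multiset.map (fun a => X - C a)
        ((Finset.univ : Finset (L ≃ₐ[K] L)).val.map fun g => g • π)).prod := by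
      rw [hQ, Finset.prod_eq_multiset_prod, Multiset.map_map]; rfl
    have hdvd : Q ∣ P.map (algebraMap R (integralClosure R L)) := by
      rw [hQeq, Multiset.prod_X_sub_C_dvd_iff_le_roots (hPmonic.map _).ne_zero,
        Multiset.le_iff_subset ((Finset.univ : Finset (L ≃ₐ[K] L)).nodup.map hinj)]
      intro a ha
      obtain ⟨g, -, rfl⟩ := Multiset.mem_map.mp ha
      rw [mem_roots (hPmonic.map _).ne_zero, IsRoot.def, eval_map_algebraMap, ← smul_aeval, hP,
        minpoly.aeval, smul_zero]
    have hfin : Module.finrank K L = p := by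
      rw [← IsGalois.card_aut_eq_finrank K L, hcard]
    have hPx : minpoly K (π : L) = P.map (algebraMap R K) := by
      rw [hP, ← minpoly.algebraMap_eq
        (FaithfulSMul.algebraMap_injective (integralClosure R L) L) π]
      exact minpoly.isIntegrallyClosed_eq_field_fractions' K hxint.algebraMap
    have hdegP : P.natDegree ≤ p := by
      have h1 : (minpoly K (π : L)).natDegree ≤ Module.finrank K L := minpoly.natDegree_le (π : L)
      rwa [hPx, hPmonic.natDegree_map, hfin] at h1
    have hPQ : P.map (algebraMap R (integralClosure R L)) = Q :=
      eq_of_monic_of_dvd_of_natDegree_le hQmonic (hPmonic.map _) hdvd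
        (by rw [hPmonic.natDegree_map, hQdeg]; exact hdegP)
    -- hence `π` generates `L/K`, and `P'(π) ∈ 𝔇`
    have hx : Algebra.adjoin K {((π : integralClosure R L) : L)} = ⊤ := by
      have hdeg : (minpoly K (π : L)).natDegree = Module.finrank K L := by
        rw [hPx, hPmonic.natDegree_map, hfin, ← hQdeg, ← hPQ, hPmonic.natDegree_map]
      have htop := (Field.primitive_element_iff_minpoly_natDegree_eq K (π : L)).mpr hdeg
      have halg : IsAlgebraic K (π : L) := Algebra.IsAlgebraic.isAlgebraic _
      rw [← IntermediateField.adjoin_simple_toSubalgebra_of_isAlgebraic halg, htop,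
        IntermediateField.top_toSubalgebra]
    have hmemD : aeval π (derivative P) ∈ differentIdeal R (integralClosure R L) :=
      aeval_derivative_mem_differentIdeal R K L π hx
    have hmem2 : aeval π (derivative P) ∈ 𝔓 ^ (2 * p) :=
      le_ordIdeal_iff_mem_pow.mp (hle.trans
        (emultiplicity_le_emultiplicity_of_dvd_right (Ideal.dvd_span_singleton.mpr hmemD)))
    -- `P'(π) = Σ_{n ≤ p} aₙ n π^{n-1}` with `aₙ = Q.coeff n`
    set c : ℕ → integralClosure R L := fun n => Q.coeff n * n * π ^ (n - 1) with hc
    have hexp : aeval π (derivative P) = ∑ n ∈ Finset.range (p + 1), c n := by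
      rw [← eval_map_algebraMap, ← derivative_map, hPQ, derivative_eval,
        sum_over_range' _ (fun n => by simp) (p + 1) (by rw [hQdeg]; omega)]
    -- orders of the data
    have hp𝔭' : (p : R) ∈ 𝔓.under R := by
      rw [Ideal.under_def, Ideal.mem_comap, map_natCast]; exact hpP
    have hordp : ord 𝔓 ((p : ℕ) : integralClosure R L) = p := by
      rw [← map_natCast (algebraMap R (integralClosure R L)) p,
        ord_algebraMap_eq_card_mul R 𝔓 h𝔓 htot, hcard, ord_eq_one (𝔓.under R) hp𝔭' hp𝔭, mul_one]
    have hordπ : ord 𝔓 π = 1 := ord_eq_one 𝔓 hπ hπ2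
    have hordn : ∀ n : ℕ, 0 < n → n < p → ord 𝔓 ((n : ℕ) : integralClosure R L) = 0 := by
      intro n hn0 hnp
      rw [ord_eq_zero_iff]
      intro hmem
      have hcop := (Nat.isCoprime_iff_coprime.mpr (Nat.coprime_of_lt_prime hn0.ne' hnp hp)).map
          (Int.castRingHom (integralClosure R L))
      simp only [eq_intCast, Int.cast_natCast] at hcop
      obtain ⟨a, b, hab⟩ := hcop
      apply (Ideal.IsMaximal.ne_top inferInstance : 𝔓 ≠ ⊤)
      rw [Ideal.eq_top_iff_one, ← hab]
      refine add_mem (Ideal.mul_mem_left _ _ ?_) (Ideal.mul_mem_left _ _ ?_) <;>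
        first | exact hmem | exact hpP
    have hcoeff_lt : ∀ n : ℕ, n < p → ∃ k : ℕ∞, ord 𝔓 (Q.coeff n) = p * k := by
      intro n hn
      have h1 : Q.coeff n = algebraMap R (integralClosure R L) (P.coeff n) := by
        rw [← hPQ, coeff_map]
      refine ⟨ord (𝔓.under R) (P.coeff n), ?_⟩
      rw [h1, ord_algebraMap_eq_card_mul R 𝔓 h𝔓 htot, hcard]
    have hcoeff_mem : ∀ n : ℕ, n < p → Q.coeff n ∈ 𝔓 := by
      intro n hn
      have hmapQ : Q.map (Ideal.Quotient.mk 𝔓) = X ^ p := by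
        rw [hQ, Polynomial.map_prod]
        simp only [Polynomial.map_sub, map_X, map_C, (Ideal.Quotient.eq_zero_iff_mem).mpr (hgπ _),
          map_zero, sub_zero, Finset.prod_const, Finset.card_univ, hcardF]
      have h2 := congrArg (fun q : (integralClosure R L ⧸ 𝔓)[X] => q.coeff n) hmapQ
      simp only [coeff_map, coeff_X_pow, if_neg hn.ne] at h2
      exact (Ideal.Quotient.eq_zero_iff_mem).mp h2
    have hcoeff_p : Q.coeff p = 1 := by rw [← hQdeg]; exact hQmonic.coeff_natDegree
    -- every term `c n`, `0 < n ≤ p`, has order `≡ n - 1 (mod p)`; the term `n = p` has order `2p-1`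
    have hform : ∀ n : ℕ, 0 < n → n ≤ p → ∃ k : ℕ∞, ord 𝔓 (c n) = p * k + ((n - 1 : ℕ) : ℕ∞) := by
      intro n hn0 hnp
      rcases hnp.lt_or_eq with hlt | rfl
      · obtain ⟨k, hk⟩ := hcoeff_lt n hlt
        refine ⟨k, ?_⟩
        rw [hc]
        dsimp only
        rw [ord_mul 𝔓 h𝔓, ord_mul 𝔓 h𝔓, hk, hordn n hn0 hlt, ord_pow 𝔓 h𝔓, hordπ, add_zero,
          mul_one]
      · refine ⟨1, ?_⟩
        rw [hc]
        dsimp only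
        rw [hcoeff_p, one_mul, ord_mul 𝔓 h𝔓, ord_pow 𝔓 h𝔓, hordp, hordπ, mul_one, mul_one]
    have hcp : ord 𝔓 (c p) = ((2 * p - 1 : ℕ) : ℕ∞) := by
      rw [hc]
      dsimp only
      rw [hcoeff_p, one_mul, ord_mul 𝔓 h𝔓, ord_pow 𝔓 h𝔓, hordp, hordπ, mul_one]
      norm_cast
      omega
    -- pairwise distinct orders
    have hdist : ∀ i ∈ Finset.range (p + 1), ∀ j ∈ Finset.range (p + 1),
        ord 𝔓 (c i) = ord 𝔓 (c j) → ord 𝔓 (c i) ≠ ⊤ → i = j := by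
      intro i hi j hj hij hfinite
      have hc0 : c 0 = 0 := by rw [hc]; simp
      have hi0 : i ≠ 0 := by rintro rfl; rw [hc0, ord_zero] at hfinite; exact hfinite rfl
      have hj0 : j ≠ 0 := by
        rintro rfl; rw [hij, hc0, ord_zero] at hfinite; exact hfinite rfl
      obtain ⟨ki, hki⟩ := hform i (Nat.pos_of_ne_zero hi0) (by have := Finset.mem_range.mp hi; omega)
      obtain ⟨kj, hkj⟩ := hform j (Nat.pos_of_ne_zero hj0) (by have := Finset.mem_range.mp hj; omega)
      have hki' : ki ≠ ⊤ := by rintro rfl; rw [hki] at hfinite; simp [hp.ne_zero] at hfinite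
      have hkj' : kj ≠ ⊤ := by
        rintro rfl; rw [hij, hkj] at hfinite; simp [hp.ne_zero] at hfinite
      obtain ⟨a, rfl⟩ := ENat.ne_top_iff_exists.mp hki'
      obtain ⟨b, rfl⟩ := ENat.ne_top_iff_exists.mp hkj'
      rw [hki, hkj] at hij
      have hij' : p * a + (i - 1) = p * b + (j - 1) := by exact_mod_cast hij
      have := congrArg (· % p) hij'
      simp only [Nat.mul_add_mod] at this
      have hi' := Finset.mem_range.mp hi
      have hj' := Finset.mem_range.mp hj
      rw [Nat.mod_eq_of_lt (by omega), Nat.mod_eq_of_lt (by omega)] at this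
      omega
    have hall := mem_pow_of_sum_mem_pow 𝔓 (Finset.range (p + 1)) c hdist (hexp ▸ hmem2)
    have hcp' := (mem_pow_iff_le_ord 𝔓).mp (hall p (Finset.mem_range.mpr (Nat.lt_succ_self p)))
    rw [hcp] at hcp'
    have : 2 * p ≤ 2 * p - 1 := by exact_mod_cast hcp'
    have := hp.pos
    omega
  -- conclusion
  refine ⟨t, ht1, hidx, hHilb.trans hsum, ?_⟩
  rw [hHilb, hsum, not_le] at hbound
  exact_mod_cast hbound

end Literature.NumberTheory.GaloisRepresentations
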